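import Summits.QuantumFields.BalabanUV.T4Continuum.Support.NE3LadderCovariantDifference
import Literature.MathematicalPhysics.QuantumFieldTheory.Balaban1983to89.B8Lemma1NonAbelian
import HarnessLib

/-!
# T⁴ programme, node NE3 — census R39 (brick (i), file 2): IN THE AXIAL GAUGE TWO CONSECUTIVE `μ`-BONDS ARE LADDER HOLONOMIES AT BASE POINTS `w − e_μ`, `w`, SO THEIR
# DIFFERENCE IS THE COVARIANT `μ`-DIFFERENCE OF FILE 1: `‖E(x,μ) − E(x−e_μ,μ)‖ ≤ |Q|·x₁ + 2|Q|²·x²`, `|Q| = |lowPart_μ(x − base)|₁`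

Cell `pub-balaban-gaps` (YM blitz, track G2, seat `ne3`, unit `pub-balaban-gaps-ne3-g8`; writer prover-pub-balaban-gaps-ne3-g8-0, 2026-08-24), census
`run/shared/lean/pub/pub-balaban-gaps/ne/NE3.md` §4 R39, §14.  Over file 1 (`NE3LadderCovariantDifference.ladder_covDiff_le`) and the axial-gauge kit of
[Balaban1985Averaging] pp. 24–25 (`B8Lemma1NonAbelian`: `axial_bond_eq_sharp`, `axial_treeBond_eq_one`):
* §1 `treeWord_add_of_separated` — the tree word of `u + v` is the tree word of `u` followed by that of `v` when `u` lives on the coordinates `≥ μ` and `v` on those `< μ`;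
  `hol_axial_treeWord_of_separated` — hence in the axial gauge based at `y` the tree word of `v` spelled from `y + u` has trivial holonomy.
* §2 `smallField_gaugeAct`, `norm_plaqGrad_gaugeAct` — the plaquette radius and the covariant plaquette `μ`-gradient are gauge invariant.
* §3 **`norm_axial_bond_sub_bond_le`** — for unitary `W` with `SmallField W x` and covariant plaquette gradients `≤ x₁`, base `y`, and a site `xs` with `y ≤ xs − e_μ`:
  `‖W^{axial_y}(xs, μ) − W^{axial_y}(xs − e_μ, μ)‖ ≤ |Q|·x₁ + 2|Q|²·x²`, `|Q| = |lowPart_μ(xs − y)|₁` (both bonds are `Λ(w) = V₀(w; ladder_Q μ)`, `Λ(w − e_μ)` with the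
  tree holonomies of `axial_bond_eq_sharp` equal to `1` by §1, the tree bond `(w − e_μ, μ)` trivial, and file 1).
File 3 (`Spine/NE3/AxialGaugeDivergence`) sums §3 over `μ` on a cube and feeds `LandauCorrectionSupB8LocalGauge.supRegularity_of_axialDivergence`.

CONTENT (0 sorry; no `def`; [folklore]).  HONEST FRAMING.  Kinematics of an arbitrary unitary lattice configuration in its axial gauge; nothing about Bałaban's minimisers;
(H0_W)∕`hK` at curved `W`, the covariant root and **NE3 are NOT proved** here; spine PROVED 0∕9; finite T⁴ rung (B)+1 — NOT infinite volume, NOT mass gap, NOT `BetaPertH`,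
NOT Clay.  PLACEMENT: `Summits/QuantumFields/BalabanUV/T4Continuum/Support/`.
-/

set_option autoImplicit false

open scoped BigOperators Matrix Matrix.Norms.L2Operator
open NormedSpace Finset

namespace Summit.QuantumFields.BalabanUV.T4Continuum.NE3AxialGaugeLadder

open Literature.MathematicalPhysics.QuantumFieldTheory.Balaban1983to89
open B7Prop1Explicit B7Prop2Explicit
open B8Lemma1NonAbelian (lowPart lowPart_apply lowPart_sub lowPart_nonneg lowPart_le_self axial_bond_eq_sharp axial_treeBond_eq_one
  forward_of_mem_treeWord ne_zero_of_mem_treeWord pairwise_gt_finRange_reverse)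
open T4AveragingDeficitWall (Ad IsUnitaryCfg SmallField)
open T4AveragingDeficitNonAbelian (Ad_mul Ad_sub)
open AveragingDeficitNearIdentity (Ad_one)
open AveragingDeficitTransport (norm_Ad_of_unitary mem_U1_of_unitary)
open NE3LadderCovariantDifference (ladder_covDiff_le)

noncomputable section

variable {d : ℕ} {n : Type*} [Fintype n] [DecidableEq n]

/-! ## §1 Tree words of separated vectors; trivial tree holonomies in the axial gauge -/

/-- **SEPARATED TREE WORDS CONCATENATE**: if `u κ = 0` for `κ < μ` and `v κ = 0` for `μ ≤ κ` then `treeWord u ++ treeWord v = treeWord (u + v)` (the tree word walks the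
coordinates in decreasing order). [folklore] -/
theorem treeWord_add_of_separated (μ : Fin d) {u v : Site d} (hu : ∀ κ, κ < μ → u κ = 0) (hv : ∀ κ, μ ≤ κ → v κ = 0) :
    treeWord u ++ treeWord v = treeWord (u + v) := by
  obtain ⟨s, t, hst⟩ := List.append_of_mem (a := μ) (l := (List.finRange d).reverse) (by simp)
  have hpw := pairwise_gt_finRange_reverse d
  rw [hst] at hpw
  have hs : ∀ κ ∈ s, μ < κ := fun κ hκ => (List.pairwise_append.mp hpw).2.2 κ hκ μ (by simp)
  have ht : ∀ κ ∈ t, κ < μ := fun κ hκ => List.rel_of_pairwise_cons (List.pairwise_append.mp hpw).2.1 hκ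
  unfold treeWord
  rw [hst]
  simp only [List.flatMap_append, List.flatMap_cons, Pi.add_apply]
  have e1 : t.flatMap (fun κ => seg κ (u κ)) = [] := List.flatMap_eq_nil_iff.mpr fun κ hκ => by rw [hu κ (ht κ hκ), seg_zero]
  have e2 : s.flatMap (fun κ => seg κ (v κ)) = [] := List.flatMap_eq_nil_iff.mpr fun κ hκ => by rw [hv κ (hs κ hκ).le, seg_zero]
  have e3 : seg μ (v μ) = [] := by rw [hv μ le_rfl, seg_zero]
  have e4 : s.flatMap (fun κ => seg κ (u κ + v κ)) = s.flatMap (fun κ => seg κ (u κ)) :=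
    flatMap_congr_of (s := s) fun κ hκ => by rw [hv κ (hs κ hκ).le, add_zero]
  have e5 : t.flatMap (fun κ => seg κ (u κ + v κ)) = t.flatMap (fun κ => seg κ (v κ)) :=
    flatMap_congr_of (s := t) fun κ hκ => by rw [hu κ (ht κ hκ), zero_add]
  rw [e1, e2, e3, e4, e5, hv μ le_rfl, add_zero]
  simp

/-- **TRIVIAL TREE HOLONOMIES IN THE AXIAL GAUGE**: with `u`, `v` separated at `μ` as above, the tree word of `v` spelled from `y + u` has holonomy `1` in the axial gauge based at `y`.
[folklore] -/
theorem hol_axial_treeWord_of_separated {G : Type*} [Group G] (V : Site d → Fin d → G) (y : Site d) (μ : Fin d) {u v : Site d}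
    (hu : ∀ κ, κ < μ → u κ = 0) (hv : ∀ κ, μ ≤ κ → v κ = 0) :
    hol (gaugeAct (axialFn V y) V) (y + u) (treeWord v) = 1 := by
  have h1 := hol_axial_treeWord V y (u + v)
  rw [← treeWord_add_of_separated μ hu hv, hol_append, hol_axial_treeWord, one_mul, disp_treeWord] at h1
  exact h1

/-! ## §2 Gauge invariance of the plaquette radius and of the covariant plaquette gradient -/

/-- The plaquette radius is gauge invariant: `SmallField W x ⟹ SmallField W^u x` for unitary `u`. [folklore] -/
theorem smallField_gaugeAct [Nonempty n] {W : Site d → Fin d → (Matrix n n ℂ)ˣ} {u : Site d → (Matrix n n ℂ)ˣ}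
    (hu : ∀ z, u z ∈ unitaryUnits (Matrix n n ℂ)) {x : ℝ} (hWx : SmallField W x) : SmallField (gaugeAct u W) x := by
  intro z κ κ' hne
  rw [hol_gaugeAct_closed _ _ _ _ (disp_plaqWord _ _), Units.val_mul, Units.val_mul]
  exact (norm_units_conj_sub_one_le (mem_U1_of_unitary (hu z)) _).trans (hWx z κ κ' hne)

/-- The covariant plaquette `μ`-gradient is gauge COVARIANT (conjugation by `u(p)`), so its norm is gauge invariant. [folklore] -/
theorem norm_plaqGrad_gaugeAct [Nonempty n] {W : Site d → Fin d → (Matrix n n ℂ)ˣ} {u : Site d → (Matrix n n ℂ)ˣ}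
    (hu : ∀ z, u z ∈ unitaryUnits (Matrix n n ℂ)) (p : Site d) (μ κ : Fin d) :
    ‖Ad (gaugeAct u W p μ) ((hol (gaugeAct u W) (p + e μ) (plaqWord κ μ) : (Matrix n n ℂ)ˣ) : Matrix n n ℂ)
        - ((hol (gaugeAct u W) p (plaqWord κ μ) : (Matrix n n ℂ)ˣ) : Matrix n n ℂ)‖
      = ‖Ad (W p μ) ((hol W (p + e μ) (plaqWord κ μ) : (Matrix n n ℂ)ˣ) : Matrix n n ℂ) - ((hol W p (plaqWord κ μ) : (Matrix n n ℂ)ˣ) : Matrix n n ℂ)‖ := by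
  have h1 : Ad (gaugeAct u W p μ) ((hol (gaugeAct u W) (p + e μ) (plaqWord κ μ) : (Matrix n n ℂ)ˣ) : Matrix n n ℂ)
      - ((hol (gaugeAct u W) p (plaqWord κ μ) : (Matrix n n ℂ)ˣ) : Matrix n n ℂ)
      = Ad (u p) (Ad (W p μ) ((hol W (p + e μ) (plaqWord κ μ) : (Matrix n n ℂ)ˣ) : Matrix n n ℂ) - ((hol W p (plaqWord κ μ) : (Matrix n n ℂ)ˣ) : Matrix n n ℂ)) := by
    have hAdU : ∀ (A Y : (Matrix n n ℂ)ˣ), Ad A (Y : Matrix n n ℂ) = ((A * Y * A⁻¹ : (Matrix n n ℂ)ˣ) : Matrix n n ℂ) := fun A Y => by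
      unfold Ad; simp only [Units.val_mul]
    have hgu : gaugeAct u W p μ * u (p + e μ) = u p * W p μ := by unfold gaugeAct; group
    rw [hol_gaugeAct_closed _ _ _ _ (disp_plaqWord _ _), hol_gaugeAct_closed _ _ _ _ (disp_plaqWord _ _), ← hAdU, ← hAdU,
      ← Ad_mul, hgu, Ad_mul, ← Ad_sub]
  rw [h1, norm_Ad_of_unitary (hu p)]

/-! ## §3 Two consecutive `μ`-bonds in the axial gauge -/

/-- **THE DIFFERENCE OF TWO CONSECUTIVE `μ`-BONDS IN THE AXIAL GAUGE** (unitary `W`, `SmallField W x`, covariant plaquette gradients `≤ x₁`; base `y`, site `xs` with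
`y ≤ xs − e_μ`): `‖W^{axial_y}(xs, μ) − W^{axial_y}(xs − e_μ, μ)‖ ≤ |Q|·x₁ + 2|Q|²·x²`, `|Q| = |lowPart_μ(xs − y)|₁`. [folklore] -/
theorem norm_axial_bond_sub_bond_le [Nonempty n] {W : Site d → Fin d → (Matrix n n ℂ)ˣ} (hWu : IsUnitaryCfg W) {x x₁ : ℝ} (hx0 : 0 ≤ x)
    (hWx : SmallField W x)
    (hgrad : ∀ (p : Site d) (μ κ : Fin d), κ ≠ μ →
      ‖Ad (W p μ) ((hol W (p + e μ) (plaqWord κ μ) : (Matrix n n ℂ)ˣ) : Matrix n n ℂ) - ((hol W p (plaqWord κ μ) : (Matrix n n ℂ)ˣ) : Matrix n n ℂ)‖ ≤ x₁)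
    (y xs : Site d) (μ : Fin d) (hy : y ≤ xs - e μ) :
    ‖((gaugeAct (axialFn W y) W xs μ : (Matrix n n ℂ)ˣ) : Matrix n n ℂ) - ((gaugeAct (axialFn W y) W (xs - e μ) μ : (Matrix n n ℂ)ˣ) : Matrix n n ℂ)‖
      ≤ (l1 (lowPart μ (xs - y)) : ℝ) * x₁ + 2 * (l1 (lowPart μ (xs - y)) : ℝ) ^ 2 * x ^ 2 := by
  set V₀ : Site d → Fin d → (Matrix n n ℂ)ˣ := gaugeAct (axialFn W y) W with hV₀
  have hau : ∀ z, axialFn W y z ∈ unitaryUnits (Matrix n n ℂ) := fun z => hol_mem_of (S := unitaryUnits (Matrix n n ℂ)) hWu _ _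
  have hV₀u : IsUnitaryCfg V₀ := fun z κ =>
    (unitaryUnits _).mul_mem ((unitaryUnits _).mul_mem (hau z) (hWu z κ)) ((unitaryUnits _).inv_mem (hau _))
  have hV₀x : SmallField V₀ x := smallField_gaugeAct hau hWx
  have hV₀g : ∀ (p : Site d) (κ : Fin d), κ ≠ μ →
      ‖Ad (V₀ p μ) ((hol V₀ (p + e μ) (plaqWord κ μ) : (Matrix n n ℂ)ˣ) : Matrix n n ℂ) - ((hol V₀ p (plaqWord κ μ) : (Matrix n n ℂ)ˣ) : Matrix n n ℂ)‖ ≤ x₁ :=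
    fun p κ hκ => by rw [hV₀, norm_plaqGrad_gaugeAct hau]; exact hgrad p μ κ hκ
  -- the low part, the word, the base points
  have hyx : y ≤ xs := hy.trans fun i => by simp only [Pi.sub_apply]; linarith [show (0 : ℤ) ≤ e μ i by rw [e_apply]; split_ifs <;> norm_num]
  set Lo : Site d := lowPart μ (xs - y) with hLo
  have hLo0 : 0 ≤ Lo := lowPart_nonneg μ (sub_nonneg.mpr hyx)
  set Q : List (Letter d) := treeWord Lo with hQdef
  have hQf : ∀ l ∈ Q, l.2 = true ∧ l.1 ≠ μ := by
    intro l hl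
    refine ⟨by have := forward_of_mem_treeWord hLo0 hl; rw [this], fun hlμ => ?_⟩
    have h0 := ne_zero_of_mem_treeWord hl
    rw [hlμ, hLo, lowPart_apply, if_neg (lt_irrefl μ)] at h0
    exact h0 rfl
  have hlen : (Q.length : ℝ) = l1 Lo := by rw [hQdef, length_treeWord]
  set w : Site d := xs - Lo with hw
  -- `Lo` is also the low part of `xs − e_μ − y`, and `w − e_μ = (xs − e_μ) − Lo`
  have hLo' : lowPart μ (xs - e μ - y) = Lo := by
    rw [show xs - e μ - y = (xs - y) - e μ by abel, lowPart_sub, hLo]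
    have : lowPart μ (e μ : Site d) = 0 := by
      funext κ; rw [lowPart_apply, e_apply]; split_ifs with h1 h2 <;> simp_all
    rw [this, sub_zero]
  -- separation data: `w − y` and `w − e_μ − y` vanish below `μ`, `Lo` vanishes at and above `μ`
  have hu : ∀ κ, κ < μ → (w - y) κ = 0 := fun κ hκ => by
    simp only [hw, hLo, Pi.sub_apply, lowPart_apply, if_pos hκ]; ring
  have hu' : ∀ κ, κ < μ → (w - e μ - y) κ = 0 := fun κ hκ => by
    have h1 := hu κ hκ
    simp only [Pi.sub_apply] at h1 ⊢
    rw [e_apply, if_neg (ne_of_lt hκ)]; linarith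
  have hv : ∀ κ, μ ≤ κ → Lo κ = 0 := fun κ hκ => by rw [hLo, lowPart_apply, if_neg (not_lt.mpr hκ)]
  -- the three trivial tree holonomies
  have hH : hol V₀ w Q = 1 := by
    have h := hol_axial_treeWord_of_separated W y μ hu hv
    rwa [show y + (w - y) = w by abel] at h
  have hHt : hol V₀ (w - e μ) Q = 1 := by
    have h := hol_axial_treeWord_of_separated W y μ hu' hv
    rwa [show y + (w - e μ - y) = w - e μ by abel] at h
  have hUt : V₀ (w - e μ) μ = 1 := by
    refine axial_treeBond_eq_one W y (w - e μ) μ ?_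
    funext κ
    rw [lowPart_apply]
    split_ifs with hκ
    · exact hu' κ hκ
    · rfl
  -- both bonds are ladder holonomies
  have hb1 : V₀ xs μ = hol V₀ w (ladder Q μ) := by
    have h := axial_bond_eq_sharp W y xs μ
    rw [← hV₀, ← hLo, ← hw, ← hQdef, hH] at h
    simpa using h
  have hb2 : V₀ (xs - e μ) μ = hol V₀ (w - e μ) (ladder Q μ) := by
    have h := axial_bond_eq_sharp W y (xs - e μ) μ
    rw [← hV₀, hLo', ← hQdef, show xs - e μ - Lo = w - e μ by rw [hw]; abel, hHt] at h
    simpa using h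
  -- file 1
  obtain ⟨-, hD⟩ := ladder_covDiff_le hV₀u μ hx0 hV₀x hV₀g Q hQf w
  rw [hUt, Ad_one] at hD
  rw [hb1, hb2, ← hlen]
  exact hD

end

end Summit.QuantumFields.BalabanUV.T4Continuum.NE3AxialGaugeLadder
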